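import Summits.BirchSwinnertonDyer.BirchSwinnertonDyer.Theorems.ErratumRoadFiveIMCDivRoadFFSigmaDataBOfSigmaLocal
import Summits.BirchSwinnertonDyer.BirchSwinnertonDyer.Theorems.ErratumRoadFiveControlOfFacts
import HarnessLib

/-!
# Route `ErratumRoadFive` (rung K2, `p ≥ 5`), Road FF: the `Σ`-DATA AT EVERY ERRATUM DATUM from the LOCAL fact + Shapiro
# WITHOUT the Jetchev–Skinner–Wan control fact — the torsion of `X^∅_ac` comes from the tree's kernel control theorem
# (cell `bsd-stepL`, seat `bsd-stepL-imc-p1` g16; `--supports stmt-BirchSwinnertonDyer-19626`; Theses-free)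

`Theorems/ErratumRoadFiveIMCDivRoadFFSigmaDataBOfSigmaLocal.lean` (imc-p1 g12) assembles the Road-FF `Σ`-data
`P2.RoadFF.SigmaDataAt W p κ 𝔭 γ Σ P_Σ` at erratum data from (i) the LOCAL fact
`JetchevSkinnerWan2017.sigmaLocal_charIdeal_eulerFactor_mem_of_noTamagawaDefect` (K2 item 20495, CLOSED `proved`),
(ii) Shapiro `SkinnerUrban2014.prop323_XAc_equiv_XBigDecomp` (K2 item 20430, CLOSED `proved`) and (iii) the torsion of
`X^∅_ac`, there taken from JSW17 Thm. 3.3.1 (`thm331_anticyclotomicControl_mult`, K2 item 19626, PUB binder `h331` of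
`closes`). Here (iii) is supplied instead by `P2.RoadFF.isTorsion_XAc_empty_of_facts_of_isErratumField`
(`Theorems/ErratumRoadFiveControlOfFacts.lean` §3: the tree's kernel control theorem
`X11b.controlOnTreeAt_of_mult_of_rankOne_odd` at the erratum field), so the `Σ`-data need only GZK, modularity and the
two Poitou–Tate facts — conjuncts of `PublishedInputsIMCReduction` — besides (i) and (ii):

* `P2.RoadFF.sigmaDataAt_of_sigmaLocal_of_prop323_of_facts_of_isErratumField` (one erratum field, any slot),
* **`P2.RoadFF.sigmaDataAtErratumDataB_of_sigmaLocal_of_prop323_of_facts`** (every erratum datum, every X-slot `𝔭bar`)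
  — drop-in replacement for `P2.RoadFF.sigmaDataAtErratumDataB_of_sigmaLocal_of_prop323_of_thm331` in the `have h3`
  line of `Theses.ErratumRoadFive.closes`, with `h331 ↦ hPT, hPT2`;
* `P2.RoadFF.sigmaDataAtErratumData_of_sigmaLocal_of_prop323_of_facts` (the A-slot twin).

HONEST FRAMING: theorems only (no definition, no named fact, no `sorry`); CONDITIONAL on the named facts (the local
fact, SU14 Prop. 3.2.3, GZK, modularity, Poitou–Tate for Selmer structures and for `Ш`); nothing is booked; item 19626
is not closed; BSD is proved for no pair; no count moves (T7).

References: [JetchevSkinnerWan2017] §5.1, proof of Thm. 6.1.6, Thm. 3.3.1 with §3.5 (3.5.c); [SkinnerUrban2014]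
Prop. 3.2.3; [Castella2018] Def. 2.2, (2.7), Prop. 2.5, Thm. 2.3; [Castella2018Erratum] proof of Thm. 1.1 (p. 4);
[MilneADT2006] I Thm. 4.10, Thm. 2.8.
-/

set_option autoImplicit false
set_option linter.dupNamespace false

noncomputable section

open scoped Classical

open WeierstrassCurve NumberField IsDedekindDomain Field PowerSeries
open Literature.NumberTheory.EllipticCurves Literature.NumberTheory.EllipticCurves.GreenbergSelmer
  Literature.NumberTheory.EllipticCurves.ModularForms Literature.NumberTheory.EllipticCurves.Rank1Residual
  Literature.NumberTheory.EllipticCurves.Rank1Residual.Typed Literature.NumberTheory.EllipticCurves.Castella2018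
  Literature.NumberTheory.EllipticCurves.JetchevSkinnerWan2017 Literature.NumberTheory.GaloisRepresentations
  Literature.NumberTheory.GaloisCohomology
open Summit.BirchSwinnertonDyer.Rank1Residual.X11b.AcSelmer Summit.BirchSwinnertonDyer.Rank1Residual.X11b.Halves
open Summit.BirchSwinnertonDyer.Rank1Residual

namespace Summit.BirchSwinnertonDyer.Rank1Residual.X11b

section SigmaData

variable (W : WeierstrassCurve ℚ) [W.IsElliptic] [W.IsGloballyMinimal] (p : ℕ) [Fact p.Prime]
  {K : Type} [Field K] [NumberField K]

/-- **`Σ`-data at an erratum field, ANY X-slot `v ∋ p`, from the LOCAL fact + Shapiro + the kernel control theorem.**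
Hypotheses as in `P2.RoadFF.sigmaDataAt_of_sigmaLocal_of_prop323_of_thm331_of_isErratumField` with `h331` REPLACED by
the two Poitou–Tate facts `hPT`, `hPT2` (the torsion of `X^∅_ac` by `P2.RoadFF.isTorsion_XAc_empty_of_facts_of_isErratumField`);
conclusion `P2.RoadFF.SigmaDataAt W p κ v γ ↑Σ(W,p)(K) (P_Σ)` at the typer's concrete choice terms. The no-defect binder,
the Euler data and `P_Σ ≠ 0` are discharged exactly as there. CONDITIONAL on `hloc`, `h323`, `hGZK`, `hnf`, `hPT`, `hPT2`.
[cite: JetchevSkinnerWan2017, proof of Thm. 6.1.6 (arXiv:1512.06894 tex p0026 L82–96) and Thm. 3.3.1 with §3.5 (3.5.c)]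
[cite: SkinnerUrban2014, Prop. 3.2.3 (Shapiro)] [cite: Castella2018, Thm. 2.3 (2.7) and Prop. 2.5 (arXiv:1704.06608 p. 7)] -/
theorem P2.RoadFF.sigmaDataAt_of_sigmaLocal_of_prop323_of_facts_of_isErratumField
    (hloc : sigmaLocal_charIdeal_eulerFactor_mem_of_noTamagawaDefect)
    (h323 : SkinnerUrban2014.prop323_XAc_equiv_XBigDecomp)
    (hGZK : rank_eq_analyticRank_of_analyticRank_le_one) (hnf : exists_isNewformOf)
    (hPT : ∀ (K : Type) [Field K] [NumberField K], poitouTate_selmerStructure_duality K)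
    (hPT2 : ∀ (K : Type) [Field K] [NumberField K], poitouTate_sha_tateDual K)
    (hE : ErratumHypotheses W p) (hr : W.analyticRank = 1) {q : ℕ} [Fact q.Prime] (hqp : q ≠ p)
    (hmq : Mult W q) (hnsq : ¬ W.HasSplitMultiplicativeReductionAtPrime q)
    (hvq : ¬ p ∣ padicValInt q W.minimalDiscriminantInt) (hK : IsErratumField W K q)
    (P : (W.baseChange K).toAffine.Point) (hP : ¬ IsOfFinAddOrder P)
    (κ : ZpExtension K p) (hκ : κ.IsAnticyclotomic) (γ : Field.absoluteGaloisGroup K)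
    [Fact (κ.IsTopGenerator γ)] (v : HeightOneSpectrum (𝓞 K)) (hv : ((p : ℕ) : 𝓞 K) ∈ v.asIdeal) :
    P2.RoadFF.SigmaDataAt W p κ v γ (↑(W.sigmaPlacesFinset p K) : Set (HeightOneSpectrum (𝓞 K)))
      (W.sigmaEulerElement p K κ) := by
  have hp3 : 3 < p := lt_of_lt_of_le (by norm_num) hE.1
  have hmult : Mult W p := hE.2.1
  have hsp : SplitsIn K p := hK.splitsIn_of_mult hmult (Ne.symm hqp)
  have hHp : SatisfiesHeegnerHypothesis p K := satisfiesHeegnerHypothesis_of_splitsIn Fact.out hsp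
  have hT₀ := P2.RoadFF.isTorsion_XAc_empty_of_facts_of_isErratumField W p hGZK hnf hPT hPT2 hE hr hqp hmq hvq
    hK P hP κ hκ γ v hv
  have hB := W.noTamagawaDefect_sigmaPlaces_of_splitMult_imp_degree_one p K hK.1 hp3 κ hκ
    (P2.RoadFF.splitMult_sigmaPlaces_degreeOne_of_isErratumField W p hmq hnsq hK)
  obtain ⟨hT, hCh⟩ := isTorsion_XAc_and_charIdeal_empty_mul_le_of_sigmaLocal_of_prop323 W p hp3.le K hK.1
    hHp v hv κ hκ γ (W.sigmaPlacesFinset p K) (W.forall_mem_sigmaPlacesFinset_not_mem p K) _ _ _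
    (W.isEulerDataAt_of_mem_sigmaPlacesFinset p K κ) hB hloc h323 hT₀
  exact ⟨Finset.finite_toSet _, hT, W.sigmaEulerElement_ne_zero p K κ, hCh⟩

/-- **THE `Σ`-STUB OF CRUX 20169's SKELETON WITHOUT THE CONTROL FACT**: `P2.RoadFF.SigmaDataAtErratumDataB W p Σ(·) P_Σ(·)`
at every erratum datum and every X-slot `𝔭bar`, from the LOCAL fact (K2 item 20495, proved) + Shapiro (K2 item 20430,
proved) + GZK + modularity + the two Poitou–Tate facts — NO `thm331_anticyclotomicControl_mult` (K2 item 19626).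
Drop-in replacement for `P2.RoadFF.sigmaDataAtErratumDataB_of_sigmaLocal_of_prop323_of_thm331` in the `have h3` line of
`Theses.ErratumRoadFive.closes`. CONDITIONAL on the named facts; nothing booked.
[cite: JetchevSkinnerWan2017, proof of Thm. 6.1.6 and Thm. 3.3.1 with §3.5 (3.5.c) (arXiv:1512.06894)]
[cite: SkinnerUrban2014, Prop. 3.2.3 (Shapiro)] [cite: Castella2018Erratum, proof of Thm. 1.1 (p. 4)] -/
theorem P2.RoadFF.sigmaDataAtErratumDataB_of_sigmaLocal_of_prop323_of_facts
    (hloc : sigmaLocal_charIdeal_eulerFactor_mem_of_noTamagawaDefect)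
    (h323 : SkinnerUrban2014.prop323_XAc_equiv_XBigDecomp)
    (hGZK : rank_eq_analyticRank_of_analyticRank_le_one) (hnf : exists_isNewformOf)
    (hPT : ∀ (K : Type) [Field K] [NumberField K], poitouTate_selmerStructure_duality K)
    (hPT2 : ∀ (K : Type) [Field K] [NumberField K], poitouTate_sha_tateDual K) :
    P2.RoadFF.SigmaDataAtErratumDataB W p
      (fun K _ _ ↦ (↑(W.sigmaPlacesFinset p K) : Set (HeightOneSpectrum (𝓞 K))))
      (fun K _ _ κ _ ↦ W.sigmaEulerElement p K κ) := by
  intro _ q _ K _ _ Dt H w₀ P hE hr hqp hmq hns hvq hK hCas hP hc hinf κ hκ γ _ ι' e he 𝔭bar h𝔭bar _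
  exact P2.RoadFF.sigmaDataAt_of_sigmaLocal_of_prop323_of_facts_of_isErratumField W p hloc h323 hGZK hnf hPT hPT2
    hE hr hqp hmq hns hvq hK P hinf κ hκ γ 𝔭bar h𝔭bar

/-- **The A-slot twin** (X-slot = the datum's prime `𝔭_{ι'}`), from the same named facts without the control fact;
nothing booked. [cite: JetchevSkinnerWan2017, proof of Thm. 6.1.6 and Thm. 3.3.1 (arXiv:1512.06894)]
[cite: SkinnerUrban2014, Prop. 3.2.3] -/
theorem P2.RoadFF.sigmaDataAtErratumData_of_sigmaLocal_of_prop323_of_facts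
    (hloc : sigmaLocal_charIdeal_eulerFactor_mem_of_noTamagawaDefect)
    (h323 : SkinnerUrban2014.prop323_XAc_equiv_XBigDecomp)
    (hGZK : rank_eq_analyticRank_of_analyticRank_le_one) (hnf : exists_isNewformOf)
    (hPT : ∀ (K : Type) [Field K] [NumberField K], poitouTate_selmerStructure_duality K)
    (hPT2 : ∀ (K : Type) [Field K] [NumberField K], poitouTate_sha_tateDual K) :
    P2.RoadFF.SigmaDataAtErratumData W p
      (fun K _ _ ↦ (↑(W.sigmaPlacesFinset p K) : Set (HeightOneSpectrum (𝓞 K))))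
      (fun K _ _ κ _ ↦ W.sigmaEulerElement p K κ) := by
  intro _ q _ K _ _ Dt H w₀ P hE hr hqp hmq hns hvq hK hCas hP hc hinf κ hκ γ _ ι' e he
  exact P2.RoadFF.sigmaDataAt_of_sigmaLocal_of_prop323_of_facts_of_isErratumField W p hloc h323 hGZK hnf hPT hPT2
    hE hr hqp hmq hns hvq hK P hinf κ hκ γ _ (natCast_mem_primeOfEmbeddingDatum p ι' w₀.embedding)

end SigmaData

end Summit.BirchSwinnertonDyer.Rank1Residual.X11b

end
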